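import Mathlib
import Summits.NavierStokesRegularity.NavierStokesRegularity.Theorems.WakeRatchetTailRatchetRelayDrainFreeSlow
import HarnessLib

/-!
# `WakeRatchet.TailRatchet` (stmt-NavierStokesRegularity-21808): the drain-free front equation for time ratio
# `1 < s < 2` — positive solutions are NOT integrable (census item G0(ii), part 2)

Support file for the crux `TailRatchet` (route `WakeRatchet`; MODEL lattice ODEs of Tao 2016 §1.2, §4 — nothing
in this file is a statement about the Navier–Stokes equations, and no item is closed here).

Continuation of `…RelayDrainFreeSlow` (lower bound `b(t) ≥ b(0)e^{(4/s²)b(0)t}`, smallness of `|t|b(t)` under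
integrability) for the drain-free scalar front equation `b' = (4/s²) b(t/s)²`, `1 < s < 2`:

* `sup_step` — if `|t|b(t) ≤ M` on `t ≤ T` then `|t|b(t) ≤ 4M²` on `t ≤ sT` (the comparison function
  `b + 4M²/t` is non-increasing since `b' = (4/s²)b(t/s)² ≤ 4M²/t²`, and `b(T') → 0` far out);
* `sup_iterate` — hence from `|t|b ≤ 1/12` on `t ≤ T₀`: `|t|b(t) ≤ ¼e^{−2^k}` on `t ≤ s^kT₀`;
* `not_integrableOn` — **a solution positive on `(−∞,0]` is never integrable on `(−∞,0)`** (`2^k ≫ s^k` for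
  `s < 2` contradicts the exponential lower bound at `t = s^kT₀`).

With `…RelayDrainFreeSignChange` (`s > 2`: sign change) this is the analytic content of the numerical record of
`…RelayDrainFreeUnique`: the drain-free axis `δ = 0` carries an admissible (positive, integrable) front ONLY at
the relay ratio `s = 2` (assembled in `…RelayDrainFreeRigidity`).  NUMERICAL REMARK (session script, not used):
for `1.83 < s < 2` the non-integrable positive tail is LOG-PERIODIC, `p(log|t|)/|t|` (Hopf bifurcation of the
plateau `|t|b = 1/4` at `log s = π/(3√3)`), not `1/(4|t|)`.

HONEST FRAMING: elementary real analysis of a MODEL functional ODE; the construction item and the crux stay open;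
nothing here concerns Navier–Stokes.
-/

noncomputable section

set_option linter.dupNamespace false

namespace Summit.NavierStokesRegularity.NavierStokesRegularity.Theorems

namespace WakeRatchetRelayDrainFreeSlowDecay

open Set Filter Topology MeasureTheory
open WakeRatchetRelayDrainFreeSignChange WakeRatchetRelayDrainFreeSlow

variable {s : ℝ} {b : ℝ → ℝ}

/-- **The squaring step.**  If `b` (non-negative, non-decreasing on `(−∞,0]`, arbitrarily small far out) solves
the drain-free equation and `|t|·b(t) ≤ M` for `t ≤ T` (`T < 0`), then `|t|·b(t) ≤ 4M²` for `t ≤ sT`.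
[folklore] -/
theorem sup_step (hs1 : 1 < s) (hc : ContinuousOn b (Iic 0))
    (hd : ∀ t : ℝ, t < 0 → HasDerivAt b (4 / s ^ 2 * b (t / s) ^ 2) t)
    (hnonneg : ∀ t : ℝ, t ≤ 0 → 0 ≤ b t)
    (hsmall : ∀ ε : ℝ, 0 < ε → ∀ T : ℝ, T ≤ 0 → ∃ T' : ℝ, T' ≤ T ∧ b T' < ε)
    {T M : ℝ} (hT : T < 0) (hyp : ∀ t : ℝ, t ≤ T → (-t) * b t ≤ M) :
    ∀ t : ℝ, t ≤ s * T → (-t) * b t ≤ 4 * M ^ 2 := by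
  have hs0 : 0 < s := by linarith
  intro t ht
  have hsT : s * T ≤ T := by nlinarith
  have ht0 : t < 0 := lt_of_le_of_lt (ht.trans hsT) hT
  have hnt : 0 < -t := neg_pos.2 ht0
  -- `b t ≤ 4M²/(-t) + ε` for every `ε > 0`
  have hle : b t ≤ 4 * M ^ 2 / (-t) := by
    refine le_of_forall_pos_lt_add fun ε hε => ?_
    obtain ⟨T', hT't, hbT'⟩ := hsmall ε hε (t - 1) (by linarith)
    have hT'lt : T' < t := by linarith
    have hT'0 : T' < 0 := by linarith
    set F : ℝ → ℝ := fun x => b x + 4 * M ^ 2 * x⁻¹ with hF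
    have hF' : ∀ x ∈ Ioo T' t, HasDerivAt F (4 / s ^ 2 * b (x / s) ^ 2 + 4 * M ^ 2 * (-(x ^ 2)⁻¹)) x := by
      intro x hx
      have hx0 : x ≠ 0 := (lt_trans hx.2 ht0).ne
      exact (hd x (lt_trans hx.2 ht0)).add ((hasDerivAt_inv hx0).const_mul _)
    have hF'le : ∀ x ∈ Ioo T' t, 4 / s ^ 2 * b (x / s) ^ 2 + 4 * M ^ 2 * (-(x ^ 2)⁻¹) ≤ 0 := by
      intro x hx
      have hx0 : x < 0 := lt_trans hx.2 ht0
      have hxs : x / s ≤ T := by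
        rw [div_le_iff₀ hs0]
        calc x ≤ t := hx.2.le
          _ ≤ s * T := ht
          _ = T * s := mul_comm _ _
      have hxs0 : x / s < 0 := div_neg_of_neg_of_pos hx0 hs0
      have h1 : (-(x / s)) * b (x / s) ≤ M := hyp (x / s) hxs
      have h2 : 0 ≤ b (x / s) := hnonneg _ hxs0.le
      -- `b(x/s) ≤ s M / (-x)`, so `b(x/s)² ≤ s² M² / x²`
      have h3 : b (x / s) ≤ s * M / (-x) := by
        rw [le_div_iff₀ (neg_pos.2 hx0)]
        have : (-(x / s)) * b (x / s) * s = b (x / s) * (-x) := by field_simp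
        nlinarith
      have h4 : b (x / s) ^ 2 ≤ (s * M / (-x)) ^ 2 := pow_le_pow_left₀ h2 h3 2
      have h5 : 4 / s ^ 2 * (s * M / (-x)) ^ 2 = 4 * M ^ 2 * (x ^ 2)⁻¹ := by
        field_simp
      have h6 : 4 / s ^ 2 * b (x / s) ^ 2 ≤ 4 * M ^ 2 * (x ^ 2)⁻¹ := by
        rw [← h5]; exact mul_le_mul_of_nonneg_left h4 (by positivity)
      linarith
    have hFc : ContinuousOn F (Icc T' t) := by
      have h1 : ContinuousOn b (Icc T' t) := hc.mono fun x hx => hx.2.trans ht0.le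
      have h2 : ContinuousOn (fun x : ℝ => x⁻¹) (Icc T' t) :=
        continuousOn_inv₀.mono fun x hx => (lt_of_le_of_lt hx.2 ht0).ne
      exact h1.add (h2.const_smul (4 * M ^ 2)) |>.congr fun x _ => by simp [hF, smul_eq_mul]
    have hanti : AntitoneOn F (Icc T' t) := by
      refine antitoneOn_of_deriv_nonpos (convex_Icc T' t) hFc ?_ ?_
      · rw [interior_Icc]; intro x hx; exact (hF' x hx).differentiableAt.differentiableWithinAt
      · rw [interior_Icc]; intro x hx
        rw [(hF' x hx).deriv]
        exact hF'le x hx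
    have hFt : F t ≤ F T' := hanti ⟨le_rfl, hT'lt.le⟩ ⟨hT'lt.le, le_rfl⟩ hT'lt.le
    have h7 : 4 * M ^ 2 * T'⁻¹ ≤ 0 :=
      mul_nonpos_of_nonneg_of_nonpos (by positivity) (inv_nonpos.2 hT'0.le)
    have h8 : 4 * M ^ 2 / (-t) = -(4 * M ^ 2 * t⁻¹) := by
      rw [div_neg, div_eq_mul_inv]
    have hFt' : b t + 4 * M ^ 2 * t⁻¹ ≤ b T' + 4 * M ^ 2 * T'⁻¹ := hFt
    rw [h8]
    linarith
  calc (-t) * b t ≤ (-t) * (4 * M ^ 2 / (-t)) := mul_le_mul_of_nonneg_left hle hnt.le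
    _ = 4 * M ^ 2 := by rw [mul_comm, div_mul_cancel₀ _ hnt.ne']

/-- `1/12 ≤ ¼·e^{−1}`. [folklore] -/
theorem twelfth_le : (1 : ℝ) / 12 ≤ 1 / 4 * Real.exp (-(2 : ℝ) ^ (0 : ℕ)) := by
  rw [pow_zero]
  have h3 : Real.exp 1 ≤ 3 := by
    have := Real.exp_one_lt_d9
    linarith
  have h1 : (1 : ℝ) / 3 ≤ Real.exp (-1) := by
    rw [Real.exp_neg, ← one_div]
    exact one_div_le_one_div_of_le (Real.exp_pos 1) h3
  linarith

/-- The squaring recursion in closed form: `4(¼e^{−2^k})² = ¼e^{−2^{k+1}}`. [folklore] -/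
theorem sq_closed_form (k : ℕ) :
    4 * (1 / 4 * Real.exp (-(2 : ℝ) ^ k)) ^ 2 = 1 / 4 * Real.exp (-(2 : ℝ) ^ (k + 1)) := by
  rw [mul_pow, sq (Real.exp _), ← Real.exp_add, pow_succ]
  ring_nf

/-- **Iterated squaring step**: from `|t| b(t) ≤ 1/12` on `t ≤ T₀`, `|t| b(t) ≤ ¼e^{−2^k}` for `t ≤ s^k T₀`.
[folklore] -/
theorem sup_iterate (hs1 : 1 < s) (hc : ContinuousOn b (Iic 0))
    (hd : ∀ t : ℝ, t < 0 → HasDerivAt b (4 / s ^ 2 * b (t / s) ^ 2) t)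
    (hnonneg : ∀ t : ℝ, t ≤ 0 → 0 ≤ b t)
    (hsmall : ∀ ε : ℝ, 0 < ε → ∀ T : ℝ, T ≤ 0 → ∃ T' : ℝ, T' ≤ T ∧ b T' < ε)
    {T₀ : ℝ} (hT₀ : T₀ < 0) (hyp : ∀ t : ℝ, t ≤ T₀ → (-t) * b t ≤ 1 / 12) :
    ∀ (k : ℕ) (t : ℝ), t ≤ s ^ k * T₀ → (-t) * b t ≤ 1 / 4 * Real.exp (-(2 : ℝ) ^ k)
  | 0 => fun t ht => by
    rw [pow_zero, one_mul] at ht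
    exact (hyp t ht).trans twelfth_le
  | k + 1 => fun t ht => by
    have hs0 : 0 < s := by linarith
    have hTk : s ^ k * T₀ < 0 := mul_neg_of_pos_of_neg (pow_pos hs0 k) hT₀
    have ih : ∀ t : ℝ, t ≤ s ^ k * T₀ → (-t) * b t ≤ 1 / 4 * Real.exp (-(2 : ℝ) ^ k) :=
      sup_iterate hs1 hc hd hnonneg hsmall hT₀ hyp k
    have h := sup_step hs1 hc hd hnonneg hsmall hTk ih t
      (by rw [pow_succ] at ht; linarith [ht, show s ^ k * s * T₀ = s * (s ^ k * T₀) by ring])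
    rw [sq_closed_form k] at h
    exact h

/-! ## No integrable positive solution for `1 < s < 2` -/

/-- **No admissible drain-free front for `1 < s < 2`.**  A solution of `b' = (4/s²)b(t/s)²` (`t < 0`) that
is continuous and positive on `(−∞,0]` is NOT integrable on `(−∞,0)`.
[cite: Tao2016AveragedNS, §1.2 (dyadic model); cell vocabulary (drain-free scalar front equation of `DyadicScalarFronts`, census item G0 of stmt-21808)] -/
theorem not_integrableOn (hs1 : 1 < s) (hs2 : s < 2) (hc : ContinuousOn b (Iic 0))
    (hd : ∀ t : ℝ, t < 0 → HasDerivAt b (4 / s ^ 2 * b (t / s) ^ 2) t)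
    (hpos : ∀ t : ℝ, t ≤ 0 → 0 < b t) : ¬ IntegrableOn b (Iio 0) := by
  intro hint
  have hs0 : 0 < s := by linarith
  have hs1' : (1 : ℝ) ≤ s := hs1.le
  have hnonneg : ∀ t : ℝ, t ≤ 0 → 0 ≤ b t := fun t ht => (hpos t ht).le
  have hmono := WakeRatchetRelayDrainFreeSlow.monotoneOn hc hd
  have hsmall : ∀ ε : ℝ, 0 < ε → ∀ T : ℝ, T ≤ 0 → ∃ T' : ℝ, T' ≤ T ∧ b T' < ε :=
    fun ε hε T hT => exists_lt_of_integrableOn hint hε hT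
  obtain ⟨T₀, hT₀, hbase⟩ := tail_small hs1 hmono hnonneg hint (by norm_num : (0 : ℝ) < 1 / 12)
  have hiter := sup_iterate hs1 hc hd hnonneg hsmall hT₀ hbase
  -- the two-sided estimate at `t_k = s^k T₀`
  set a : ℝ := -T₀ with ha
  have hapos : 0 < a := by rw [ha]; exact neg_pos.2 hT₀
  set β : ℝ := 4 / s ^ 2 * b 0 with hβ
  have hβpos : 0 < β := by rw [hβ]; exact mul_pos (by positivity) (hpos 0 le_rfl)
  have hb0 : 0 < b 0 := hpos 0 le_rfl
  have hk : ∀ k : ℕ, 4 * (a * b 0) ≤ Real.exp (β * a * s ^ k - (2 : ℝ) ^ k) := by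
    intro k
    set tk : ℝ := s ^ k * T₀ with htk
    have hsk : (1 : ℝ) ≤ s ^ k := one_le_pow₀ hs1'
    have htk0 : tk ≤ 0 := (mul_neg_of_pos_of_neg (pow_pos hs0 k) hT₀).le
    have hup : (-tk) * b tk ≤ 1 / 4 * Real.exp (-(2 : ℝ) ^ k) := hiter k tk le_rfl
    have hlow : b 0 * Real.exp (4 / s ^ 2 * b 0 * tk) ≤ b tk := lower_bound hs1 hs2 hc hd hpos htk0
    have hntk : a ≤ -tk := by
      rw [htk, ha]
      have : -(s ^ k * T₀) = s ^ k * (-T₀) := by ring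
      rw [this]
      calc -T₀ = 1 * (-T₀) := (one_mul _).symm
        _ ≤ s ^ k * (-T₀) := mul_le_mul_of_nonneg_right hsk hapos.le
    have hexp : Real.exp (4 / s ^ 2 * b 0 * tk) = Real.exp (-(β * a * s ^ k)) := by
      congr 1; rw [hβ, htk, ha]; ring
    rw [hexp] at hlow
    have h1 : a * (b 0 * Real.exp (-(β * a * s ^ k))) ≤ (-tk) * b tk := by
      calc a * (b 0 * Real.exp (-(β * a * s ^ k))) ≤ (-tk) * (b 0 * Real.exp (-(β * a * s ^ k))) :=
            mul_le_mul_of_nonneg_right hntk (by positivity)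
        _ ≤ (-tk) * b tk := mul_le_mul_of_nonneg_left hlow (hapos.le.trans hntk)
    have h2 : a * (b 0 * Real.exp (-(β * a * s ^ k))) ≤ 1 / 4 * Real.exp (-(2 : ℝ) ^ k) := h1.trans hup
    -- multiply through by `4 e^{β a s^k}`
    have h3 : Real.exp (β * a * s ^ k - (2 : ℝ) ^ k)
        = Real.exp (-(2 : ℝ) ^ k) * Real.exp (β * a * s ^ k) := by
      rw [← Real.exp_add]; ring_nf
    have h4 : Real.exp (-(β * a * s ^ k)) * Real.exp (β * a * s ^ k) = 1 := by
      rw [← Real.exp_add, neg_add_cancel, Real.exp_zero]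
    have h5 := mul_le_mul_of_nonneg_right h2 (Real.exp_pos (β * a * s ^ k)).le
    have h6 : a * (b 0 * Real.exp (-(β * a * s ^ k))) * Real.exp (β * a * s ^ k) = a * b 0 := by
      calc a * (b 0 * Real.exp (-(β * a * s ^ k))) * Real.exp (β * a * s ^ k)
          = a * b 0 * (Real.exp (-(β * a * s ^ k)) * Real.exp (β * a * s ^ k)) := by ring
        _ = a * b 0 := by rw [h4, mul_one]
    rw [h6] at h5
    rw [h3]
    linarith
  -- choose `k` with `(2/s)^k` large
  have h2s : 1 < 2 / s := by rw [lt_div_iff₀ hs0]; linarith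
  set L : ℝ := |Real.log (4 * (a * b 0))| with hL
  obtain ⟨k, hk'⟩ := pow_unbounded_of_one_lt (β * a + L + 1) h2s
  have hsk : (1 : ℝ) ≤ s ^ k := one_le_pow₀ hs1'
  have h2k : (2 : ℝ) ^ k = (2 / s) ^ k * s ^ k := by
    rw [div_pow, div_mul_cancel₀ _ (pow_ne_zero k hs0.ne')]
  have hbig : β * a * s ^ k + L + 1 ≤ (2 : ℝ) ^ k := by
    rw [h2k]
    have hL0 : 0 ≤ L := abs_nonneg _
    have : (β * a + L + 1) * s ^ k ≤ (2 / s) ^ k * s ^ k :=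
      mul_le_mul_of_nonneg_right hk'.le (by positivity)
    nlinarith
  have h6 : Real.exp (β * a * s ^ k - (2 : ℝ) ^ k) < 4 * (a * b 0) := by
    have h7 : β * a * s ^ k - (2 : ℝ) ^ k < -L := by linarith
    calc Real.exp (β * a * s ^ k - (2 : ℝ) ^ k) < Real.exp (-L) := Real.exp_lt_exp.2 h7
      _ ≤ Real.exp (Real.log (4 * (a * b 0))) := Real.exp_le_exp.2 (by rw [hL]; exact neg_abs_le _)
      _ = 4 * (a * b 0) := Real.exp_log (by positivity)
  linarith [hk k]

end WakeRatchetRelayDrainFreeSlowDecay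

end Summit.NavierStokesRegularity.NavierStokesRegularity.Theorems

end
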